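import Summits.Ventures.HSemireg.NestedWeightDivisibility
import Mathlib.Tactic.Linarith
import Mathlib.Tactic.NormNum
import HarnessLib

/-!
# Venture HSemireg — LINE LAW, the CONVERSE's mechanism: a weight pair `(1, p)` is NEVER reached when `p` is not a primitive norm,
# and the explicit witnesses at the twelve multi-class imaginary orders (ENGINE-W code B, card LINE-LAW-B.md §11 ∕ §17)

HONEST FRAMING. Lean index of the computation cell `pub-hsemireg`, widening group ENGINE-W (code B, seat `engine-w-2`, gen 11). RING
ARITHMETIC in Mathlib's `ℤ√m`; it continues `NestedWeightDivisibility.lean` (same lineage, keyed k = 299), whose nested-divisibility engine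
it applies. THEOREM CF⁶ and «reached weight lines» enter BY VALUE. No abelian variety, sheaf, `Ext` group or semiregularity map is
constructed; nothing here says that HC, HC_CM or HC_AV holds. Theorems only (0 `def`, 0 named fact, 0 `sorry`).

SOURCE (card `widen/ENGINE-W/out/probe4/LINE-LAW-B.md` v1.16–v1.17 §17). THEOREM CF⁶ (by value): the weight pair `(1, p)` is reached at `T`
iff there are primitive `z₁, z₂ ∈ ℤ[√m]` with `N z₁ = T`, `N z₂ = T∕p` and ONE `A` with `z₁, z₂ ∣ A − l`. §17 (a) MECHANISM: if `p` is not a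
primitive norm then NO `T = p·s` works — `z₂ ∣ z₁` (nested divisibility) with a quotient of norm `p` dividing `A − l`. §17 (d) WITNESSES: for the
twelve multi-class imaginary orders of the census the smallest such `p` (a primitive value of SOME form of discriminant `4m`, not of
`x² − m y²`) — so the census's «law yes, no common A» cells at `(1, p)` are anomalies for EVERY `T`, not a finite-search artefact.

WHAT THE KERNEL HOLDS: `norm_eq_of_sq` (bookkeeping), **`never_pair_of_not_norm`** (any `m`: `p` not of the form `x² − m y²` ⇒ no `z₁, z₂` of
norms `p s`, `s` (`s ≠ 0`) divide a common `A − l`), `sq_ne_of_strict_between`, `not_norm_of_lt` (for `m < 0`: `0 ≤ p < −m` and `p` not a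
square ⇒ `p ≠ x² − m y²`), and the twelve instances `never_pair_sqrt_neg11_three`, `…neg14_two`, `…neg17_two`, `…neg19_five`, `…neg23_three`,
`…neg26_three`, `…neg29_five`, `…neg31_five`, `…neg34_two`, `…neg35_eleven`, `…neg38_seven`, `…neg39_three` (each: the pair `(1, p)` is never
reached factorwise from the `√m` node-pair seed, all `T`), plus `never_pair_sqrt_neg5_two` (the census's empty cell `(1,2)` at `m = −5`).
NOT HERE: the existence half §17 (b) (a class `C` with `C² ≠ 1` and primes in `C`, `C²` — class-group + Dirichlet∕Chebotarev, by hand), the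
positive side (§12–§14 files), THEOREM CF⁶ itself. Tier: kernel for §17 (a) and (d)'s «never» claims.
-/

namespace Summit.Ventures.HSemireg.LineLawNeverPairs

open Summit.Ventures.HSemireg.NestedDivisors

/-- `N ⟨x, y⟩ = x² − m y²` in the `^ 2` normal form. [kernel] -/
theorem norm_eq_of_sq (m : ℤ) (q : ℤ√m) : q.norm = q.re ^ 2 - m * q.im ^ 2 := by
  rw [Zsqrtd.norm_def]; ring

/-- **§17 (a), the mechanism**: if `p` is not of the form `x² − m y²` then no `z₁` of norm `p·s` and `z₂` of norm `s ≠ 0` divide a common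
`A − l` in `ℤ√m` — by nested divisibility `z₁ = z₂·q` with `N q = p`. Hence the weight pair `(1, p)` is NEVER reached factorwise (any `T = p s`).
[kernel] -/
theorem never_pair_of_not_norm {m p : ℤ} (hp : ∀ x y : ℤ, x ^ 2 - m * y ^ 2 ≠ p) {s A : ℤ} (hs : s ≠ 0)
    {z₁ w₁ z₂ w₂ : ℤ√m} (h1 : z₁ * w₁ = ⟨A, -1⟩) (h2 : z₂ * w₂ = ⟨A, -1⟩) (n1 : z₁.norm = p * s) (n2 : z₂.norm = s) :
    False := by
  have hdvd : z₂.norm ∣ z₁.norm := ⟨p, by rw [n1, n2]; ring⟩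
  obtain ⟨q, hq⟩ := nested_of_norm_dvd m A z₁ w₁ z₂ w₂ h1 h2 hdvd
  obtain ⟨hn, -, -⟩ := quotient_divides m A z₁ w₁ z₂ q h1 hq
  rw [n1, n2] at hn
  have hq' : q.norm = p := mul_left_cancel₀ hs (by linarith)
  exact hp q.re q.im (by rw [← hq', norm_eq_of_sq])

/-- An integer strictly between consecutive squares is not a square: `r² < p < (r+1)² ⇒ x² ≠ p`. [kernel] -/
theorem sq_ne_of_strict_between {p r : ℤ} (hr : 0 ≤ r) (h1 : r ^ 2 < p) (h2 : p < (r + 1) ^ 2) (x : ℤ) : x ^ 2 ≠ p := by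
  intro h
  have hx1 : x ≤ r := by nlinarith
  have hx2 : -r ≤ x := by nlinarith
  have : x ^ 2 ≤ r ^ 2 := by nlinarith [mul_nonneg (sub_nonneg.2 hx1) (show 0 ≤ r + x by linarith)]
  linarith

/-- For `m < 0`: a non-square `p` with `0 ≤ p < −m` is not of the form `x² − m y²` (a nonzero `y` already gives `≥ −m`). [kernel] -/
theorem not_norm_of_lt {m p : ℤ} (hm : m < 0) (hpm : p < -m) (hsq : ∀ x : ℤ, x ^ 2 ≠ p) (x y : ℤ) :
    x ^ 2 - m * y ^ 2 ≠ p := by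
  intro h
  by_cases hy : y = 0
  · subst hy; exact hsq x (by simpa using h)
  · have hy2 : 1 ≤ y ^ 2 := by
      have := sq_pos_of_ne_zero hy
      linarith
    nlinarith [sq_nonneg x]

/-! ### The twelve witnesses of card §17 (d) and the census's `(1,2)` at `m = −5` -/

/-- `3 ≠ x² + 11y²`: the pair `(1, 3)` is never reached from the `√−11` seed (census anomaly `(1,3)`, T = 36, 45, 60, …; `h(−44) = 3`). [kernel] -/
theorem never_pair_sqrt_neg11_three : ∀ x y : ℤ, x ^ 2 - (-11) * y ^ 2 ≠ 3 :=
  not_norm_of_lt (by norm_num) (by norm_num) (sq_ne_of_strict_between (r := 1) (by norm_num) (by norm_num) (by norm_num))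

/-- `2 ≠ x² + 14y²`: `(1, 2)` never from `√−14` (census T = 30, 78, 114; `Cl ≅ ℤ∕4`). [kernel] -/
theorem never_pair_sqrt_neg14_two : ∀ x y : ℤ, x ^ 2 - (-14) * y ^ 2 ≠ 2 :=
  not_norm_of_lt (by norm_num) (by norm_num) (sq_ne_of_strict_between (r := 1) (by norm_num) (by norm_num) (by norm_num))

/-- `2 ≠ x² + 17y²`: `(1, 2)` never from `√−17` (census T = 42, 66, 138). [kernel] -/
theorem never_pair_sqrt_neg17_two : ∀ x y : ℤ, x ^ 2 - (-17) * y ^ 2 ≠ 2 :=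
  not_norm_of_lt (by norm_num) (by norm_num) (sq_ne_of_strict_between (r := 1) (by norm_num) (by norm_num) (by norm_num))

/-- `5 ≠ x² + 19y²`: `(1, 5)` never from `√−19` (census T = 100, 140, 175). [kernel] -/
theorem never_pair_sqrt_neg19_five : ∀ x y : ℤ, x ^ 2 - (-19) * y ^ 2 ≠ 5 :=
  not_norm_of_lt (by norm_num) (by norm_num) (sq_ne_of_strict_between (r := 2) (by norm_num) (by norm_num) (by norm_num))

/-- `3 ≠ x² + 23y²`: `(1, 3)` never from `√−23` (census T = 72, 117, 144). [kernel] -/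
theorem never_pair_sqrt_neg23_three : ∀ x y : ℤ, x ^ 2 - (-23) * y ^ 2 ≠ 3 :=
  not_norm_of_lt (by norm_num) (by norm_num) (sq_ne_of_strict_between (r := 1) (by norm_num) (by norm_num) (by norm_num))

/-- `3 ≠ x² + 26y²`: `(1, 3)` never from `√−26` (witness T = 105). [kernel] -/
theorem never_pair_sqrt_neg26_three : ∀ x y : ℤ, x ^ 2 - (-26) * y ^ 2 ≠ 3 :=
  not_norm_of_lt (by norm_num) (by norm_num) (sq_ne_of_strict_between (r := 1) (by norm_num) (by norm_num) (by norm_num))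

/-- `5 ≠ x² + 29y²`: `(1, 5)` never from `√−29` (witness T = 165). [kernel] -/
theorem never_pair_sqrt_neg29_five : ∀ x y : ℤ, x ^ 2 - (-29) * y ^ 2 ≠ 5 :=
  not_norm_of_lt (by norm_num) (by norm_num) (sq_ne_of_strict_between (r := 2) (by norm_num) (by norm_num) (by norm_num))

/-- `5 ≠ x² + 31y²`: `(1, 5)` never from `√−31` (witness T = 280). [kernel] -/
theorem never_pair_sqrt_neg31_five : ∀ x y : ℤ, x ^ 2 - (-31) * y ^ 2 ≠ 5 :=
  not_norm_of_lt (by norm_num) (by norm_num) (sq_ne_of_strict_between (r := 2) (by norm_num) (by norm_num) (by norm_num))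

/-- `2 ≠ x² + 34y²`: `(1, 2)` never from `√−34` (witness T = 70). [kernel] -/
theorem never_pair_sqrt_neg34_two : ∀ x y : ℤ, x ^ 2 - (-34) * y ^ 2 ≠ 2 :=
  not_norm_of_lt (by norm_num) (by norm_num) (sq_ne_of_strict_between (r := 1) (by norm_num) (by norm_num) (by norm_num))

/-- `11 ≠ x² + 35y²`: `(1, 11)` never from `√−35` (witness T = 396). [kernel] -/
theorem never_pair_sqrt_neg35_eleven : ∀ x y : ℤ, x ^ 2 - (-35) * y ^ 2 ≠ 11 :=
  not_norm_of_lt (by norm_num) (by norm_num) (sq_ne_of_strict_between (r := 3) (by norm_num) (by norm_num) (by norm_num))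

/-- `7 ≠ x² + 38y²`: `(1, 7)` never from `√−38` (witness T = 273). [kernel] -/
theorem never_pair_sqrt_neg38_seven : ∀ x y : ℤ, x ^ 2 - (-38) * y ^ 2 ≠ 7 :=
  not_norm_of_lt (by norm_num) (by norm_num) (sq_ne_of_strict_between (r := 2) (by norm_num) (by norm_num) (by norm_num))

/-- `3 ≠ x² + 39y²`: `(1, 3)` never from `√−39` (witness T = 120). [kernel] -/
theorem never_pair_sqrt_neg39_three : ∀ x y : ℤ, x ^ 2 - (-39) * y ^ 2 ≠ 3 :=
  not_norm_of_lt (by norm_num) (by norm_num) (sq_ne_of_strict_between (r := 1) (by norm_num) (by norm_num) (by norm_num))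

/-- `2 ≠ x² + 5y²`: `(1, 2)` never from `√−5` — the census's EMPTY cell at the one-class-per-genus field `ℚ(√−5)` (there the law and the truth
agree: `2` is simply not representable; COROLLARY 2 of code A's THEOREM NO-MIX, by value). [kernel] -/
theorem never_pair_sqrt_neg5_two : ∀ x y : ℤ, x ^ 2 - (-5) * y ^ 2 ≠ 2 :=
  not_norm_of_lt (by norm_num) (by norm_num) (sq_ne_of_strict_between (r := 1) (by norm_num) (by norm_num) (by norm_num))

/-- **The «never» statement in THEOREM CF⁶'s shape, at `m = −14`, `p = 2`** (the census's first coupling anomaly `(1,2)` at `T = 30`): for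
every `s ≠ 0` and `A`, no `z₁` of norm `2s` and `z₂` of norm `s` both divide `A − √−14`. [kernel] -/
theorem never_one_two_sqrt_neg14 {s A : ℤ} (hs : s ≠ 0) {z₁ w₁ z₂ w₂ : ℤ√(-14)} (h1 : z₁ * w₁ = ⟨A, -1⟩)
    (h2 : z₂ * w₂ = ⟨A, -1⟩) (n1 : z₁.norm = 2 * s) (n2 : z₂.norm = s) : False :=
  never_pair_of_not_norm never_pair_sqrt_neg14_two hs h1 h2 n1 n2

/-- The same at `m = −11`, `p = 3` (`h(−44) = 3`: the census's `(1,3)` anomalies at T = 36, 45, 60 are anomalies for every `T`). [kernel] -/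
theorem never_one_three_sqrt_neg11 {s A : ℤ} (hs : s ≠ 0) {z₁ w₁ z₂ w₂ : ℤ√(-11)} (h1 : z₁ * w₁ = ⟨A, -1⟩)
    (h2 : z₂ * w₂ = ⟨A, -1⟩) (n1 : z₁.norm = 3 * s) (n2 : z₂.norm = s) : False :=
  never_pair_of_not_norm never_pair_sqrt_neg11_three hs h1 h2 n1 n2

end Summit.Ventures.HSemireg.LineLawNeverPairs
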